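import Summits.ResolutionOfSingularities.ResolutionOfSingularities.Theorems.FrobeniusLadderFInjectiveMacaulayficationX2CubicFormFrontEnd
import HarnessLib

/-!
# T-side CLASS ROW, first application: the Fermat cubic form `F = Y₀³ + Y₁³ + Y₂³ + Y₃³` — T-instance #2 (`x² + y³ + u³ + t³ + s³`, `p ∤ 6`) RE-DERIVED from
# `X2CubicFormFrontEnd.tStepInstanceAt_of_doublePoint_cubicForm` (the class theorem consumes exactly the per-bed certificates of res-L1-w45a-lead-1 g10/g11: `prime_f`,
# `regular_off_vertex`, `prime_g`, the Euler unit)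
# (crux `FInjectiveMacaulayfication` stmt-ResolutionOfSingularities-15315, chain w45a; res-L1-w45a-plan-1 R22.5 (5b) «✓p676607 re-derived as instance»; seat res-L1-w45a-lead-1 g11)

[OURS · L1 W4.5a] Support file (`--supports stmt-ResolutionOfSingularities-15315 --as helper`); def-free; UNCONDITIONAL; no named fact; NOT a statement of any manuscript. The SAME
mathematics as ✓p676607 `X2Cubic4FloorTwoGlue.tStepInstanceAt_x2cubic4_origin` reached through the class route (consistency check of the class theorem's hypotheses; no new bed).
HONEST SCOPE: the class route is a one-step tool for the transversal-A₁ family; it does not move T″'s generality; non-vacuity (floor FULLness ✓p677842) and vertex FULLness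
(✓p678024) stay per-bed facts. AI-written (AI review is weaker than expert review).

* `dehomogenisation_fermat` — `aeval (σ a) (ΣY_j³) = 1 + Z₀³ + Z₁³ + Z₂³` for each `a`; `fermat_isHomogeneous`;
* ★ `tStepInstanceAt_fermat_via_classRow` — `TStepGerm.TStepInstanceAt p v (𝔪̃·𝒪_{Y,v})` for `f = X₄² + rename castSucc (ΣY_j³)`, every field with `2, 3 ≠ 0`.
-/

-- single-problem summit: the doubled namespace component is forced
set_option linter.dupNamespace false

noncomputable section

namespace Summit.ResolutionOfSingularities.ResolutionOfSingularities.Theorems.FInjectiveMacaulayfication.X2CubicFormFermat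

open MvPolynomial Literature.AlgebraicGeometry.Resolution AlgebraicGeometry
open Summit.ResolutionOfSingularities.ResolutionOfSingularities.Theorems.FInjectiveMacaulayfication

variable (k : Type) [Field k]

/-- The Fermat cubic form is homogeneous of degree `3`. [elementary] -/
theorem fermat_isHomogeneous : (X 0 ^ 3 + X 1 ^ 3 + X 2 ^ 3 + X 3 ^ 3 : MvPolynomial (Fin 4) k).IsHomogeneous 3 :=
  (((isHomogeneous_X_pow (R := k) (0 : Fin 4) 3).add (isHomogeneous_X_pow (R := k) (1 : Fin 4) 3)).add
    (isHomogeneous_X_pow (R := k) (2 : Fin 4) 3)).add (isHomogeneous_X_pow (R := k) (3 : Fin 4) 3)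

/-- **The four dehomogenisations of the Fermat form are `1 + Z₀³ + Z₁³ + Z₂³`.** [elementary] -/
theorem dehomogenisation_fermat (a : Fin 4) :
    MvPolynomial.aeval ((![![1, X 0, X 1, X 2], ![X 0, 1, X 1, X 2], ![X 0, X 1, 1, X 2], ![X 0, X 1, X 2, 1]] : Fin 4 → Fin 4 → MvPolynomial (Fin 3) k) a)
      (X 0 ^ 3 + X 1 ^ 3 + X 2 ^ 3 + X 3 ^ 3 : MvPolynomial (Fin 4) k) = 1 + X 0 ^ 3 + X 1 ^ 3 + X 2 ^ 3 := by
  fin_cases a <;> simp <;> ring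

/-- `f = X₄² + rename castSucc (ΣY_j³)` is g10's `X₄² + X₀³ + X₁³ + X₂³ + X₃³`. [plumbing] -/
theorem f_eq (f : MvPolynomial (Fin 5) k) (hf : f = X 4 ^ 2 + rename (Fin.castSucc : Fin 4 → Fin 5) (X 0 ^ 3 + X 1 ^ 3 + X 2 ^ 3 + X 3 ^ 3 : MvPolynomial (Fin 4) k)) :
    f = X 4 ^ 2 + X 0 ^ 3 + X 1 ^ 3 + X 2 ^ 3 + X 3 ^ 3 := by
  rw [hf]
  simp only [map_add, map_pow, rename_X]
  show (X 4 ^ 2 + (X (Fin.castSucc 0) ^ 3 + X (Fin.castSucc 1) ^ 3 + X (Fin.castSucc 2) ^ 3 + X (Fin.castSucc 3) ^ 3) : MvPolynomial (Fin 5) k) =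
    X 4 ^ 2 + X 0 ^ 3 + X 1 ^ 3 + X 2 ^ 3 + X 3 ^ 3
  have e0 : (Fin.castSucc (0 : Fin 4) : Fin 5) = 0 := rfl
  have e1 : (Fin.castSucc (1 : Fin 4) : Fin 5) = 1 := rfl
  have e2 : (Fin.castSucc (2 : Fin 4) : Fin 5) = 2 := rfl
  have e3 : (Fin.castSucc (3 : Fin 4) : Fin 5) = 3 := rfl
  rw [e0, e1, e2, e3]
  ring

/-- ★ **T-instance #2 through the class route**: for every field `k` with `2, 3 ≠ 0`, every `p`, `f = X₄² + (Y₀³ + Y₁³ + Y₂³ + Y₃³)(X₀..X₃)`: `TStepGerm.TStepInstanceAt p v (𝔪̃·𝒪_{Y,v})`,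
by ONE application of `X2CubicFormFrontEnd.tStepInstanceAt_of_doublePoint_cubicForm` to the certificates `X2Cubic4Specimen.prime_f` / `regular_off_vertex` (bed) and
`X2Cubic4FloorTwoYChart.prime_g` / `isUnit_mk_euler_g` (chart cubic `1 + ΣZ_i³`, Euler derivation made pointwise by `X2YGBlowupRegularLocal.pointwise_of_isUnit`). Same mathematics
as ✓p676607; no new bed. [OURS · application of the class theorem] -/
theorem tStepInstanceAt_fermat_via_classRow (h2 : (2 : k) ≠ 0) (h3 : (3 : k) ≠ 0) (p : ℕ) (f : MvPolynomial (Fin 5) k)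
    (hf : f = X 4 ^ 2 + rename (Fin.castSucc : Fin 4 → Fin 5) (X 0 ^ 3 + X 1 ^ 3 + X 2 ^ 3 + X 3 ^ 3 : MvPolynomial (Fin 4) k))
    (v : Spec (.of (MvPolynomial (Fin 5) k ⧸ Ideal.span {f})))
    (hv : v.asIdeal = Ideal.span (Set.range fun j : Fin 5 => Ideal.Quotient.mk (Ideal.span {f}) (X j))) :
    TStepGerm.TStepInstanceAt p v ((affineBlowup.idealSheaf (Ideal.span (Set.range fun j : Fin 5 => Ideal.Quotient.mk (Ideal.span {f}) (X j)))).comap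
      ((Spec (.of (MvPolynomial (Fin 5) k ⧸ Ideal.span {f}))).fromSpecStalk v)) := by
  have hf' := f_eq k f hf
  refine X2CubicFormFrontEnd.tStepInstanceAt_of_doublePoint_cubicForm k p _ (fermat_isHomogeneous k) f hf (X2Cubic4Specimen.prime_f k h3 f hf')
    (fun P _ hP => X2Cubic4Specimen.regular_off_vertex k h2 h3 f hf' P hP) (fun a => ?_) (fun a Q hQ hQa => ?_) v hv
  · rw [dehomogenisation_fermat]
    exact X2Cubic4FloorTwoYChart.prime_g k h3 _ rfl
  · rw [dehomogenisation_fermat] at hQa ⊢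
    exact X2YGBlowupRegularLocal.pointwise_of_isUnit (1 + X 0 ^ 3 + X 1 ^ 3 + X 2 ^ 3 : MvPolynomial (Fin 3) k) _
      (X2Cubic4FloorTwoYChart.isUnit_mk_euler_g k h3 _ rfl) Q hQ hQa

end Summit.ResolutionOfSingularities.ResolutionOfSingularities.Theorems.FInjectiveMacaulayfication.X2CubicFormFermat

end
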